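import Literature.NumberTheory.Automorphic.PairLFunctionBoundaryMoeglinWaldspurger
import Literature.NumberTheory.Automorphic.PairLFunctionBoundaryOneFamily
import Literature.NumberTheory.Automorphic.PairLFunctionPolesRankNeTwist
import Literature.NumberTheory.Automorphic.GLOneOfHeckeCharacter
import Literature.NumberTheory.GaloisRepresentations.HeckeCharacterNormCharacter
import HarnessLib

/-!
# Arthur–Clozel (2.2) off `s = 1` for pairs with a self-dual member, by de la Vallée Poussin's
argument (proofs only)

Topic `NumberTheory/Automorphic`; namespace `Literature.NumberTheory.Automorphic`. Proof file
(theorems only: no definition, no named fact, no instance) under the named fact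
`JacquetShalika1981_partialPairL_boundary_of_ne_one` of `PairLFunctionPoles` — Arthur–Clozel,
*Simple algebras, base change, and the advanced theory of the trace formula*, Ann. of Math.
Stud. 120 (1989), Ch. 3 §2, (2.2), p. 171: at the points `s₀ = 1 + it`, `t ≠ 0`, of `Re s = 1`,
`L^S(s, π ⊗ σ)` has a finite **non-zero** limit from `Re s > 1` — continuing
`PairLFunctionBoundaryMoeglinWaldspurger` (the case `σ ≅ π̃`). Here: **the case where `σ` (or `π`)
is self-dual**, `σ̃ ≅ σ` — rendered `P' = P'.conj` (`σ̃ ≅ σ̄` for unitary `σ`, `AutomorphicConjugate`)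
— granted the Mœglin–Waldspurger continuation facts of `PairLFunctionMeromorphicContinuation`
(and multiplicity one on `L²_cusp(GL_n)` to split the cases `π ≅ π̄` / `π ≇ π̄`), with **no
non-vanishing hypothesis**: the non-vanishing is *proved*, by de la Vallée Poussin's method applied
to the isobaric sum `σ ⊞ π|·|^{it} ⊞ π̃|·|^{-it}`, i.e. to the inequality

  `L^S(σ₀, σ ⊗ σ̄) · L^S(σ₀, π ⊗ π̄)² · |L^S(σ₀ + it, π ⊗ σ)|⁴ · |L^S(σ₀ + 2it, π ⊗ π)|² ≥ 1`, `σ₀ > 1`,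

which is `exp` of `∑_{v ∉ S} ∑_k q_v^{-kσ₀} (b + 2 Re(a q_v^{-ikt}))² / k ≥ 0` with `a = tr A_v^k`,
`b = tr B_v^k ∈ ℝ` (self-duality of `σ`: `B̄_v = B_v`), through the absolutely convergent expansions
`log L^S(s, α ⊗ β) = ∑_v ∑_k tr A_v^k tr B_v^k q_v^{-ks} / k` on `Re s > 1` (Jacquet–Shalika (1981),
p. 556, (1)–(5); `pairLogTerm`, with (5.3.3) and (5.1.3) the theorems
`summable_normSq_trace_satakePow_holds`, `norm_satakeParameter_le_sqrt_holds`). At `σ₀ → 1⁺` the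
left side is `O((σ₀-1)^{-3}) · O((σ₀-1)^4) · O(1) → 0` if the continuation of `L^S(s, π ⊗ σ)`
vanished at `1 + it` — three poles against four zeros. (For pairs with neither member self-dual nor
`σ ≅ π̃` the count is balanced and Shahidi's theorem remains the input, as in
`PairLFunctionBoundaryMoeglinWaldspurger`.)

Contents (all proved):

* `summable_pairLogTerm_and_partialPairL_eq_exp`, `partialPairL_eq_exp_tsum_pairLogTerm` —
  `L^S(s, α ⊗ β) = exp (∑_{(k,v)} tr A_v^k tr B_v^k q_v^{-ks}/k)` on `Re s > 1` for Satake families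
  of cuspidal representations (the proof of `multipliable_inv_satakePairPolynomial`, kept to its sum);
* `re_selfDual_comb_nonneg`, `re_pairLogTerm_comb_nonneg`,
  `one_le_norm_partialPairL_selfDual_product` — the inequality above;
* `false_of_selfDual_estimates` — the endgame (`not_isBigO_ofReal_of_one_le_norm`);
* `partialPairL_continuation_ne_zero_of_selfDual` — **a continuation of `L^S(s, π ⊗ σ)`
  differentiable at `1 + it`, `t ≠ 0`, does not vanish there when `σ` is self-dual**, granted
  Corollaire (ii) at `GL_n` and at `GL_m` and Corollaire (i)(b) with multiplicity one at `GL_n`;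
* `JacquetShalika1981_partialPairL_boundary_of_ne_one_of_selfDual_of_MW_of_rank_ne` (`n ≠ m`,
  `σ` self-dual), `…_of_selfDual_left_of_MW_of_rank_ne` (`π` self-dual), `…_of_selfDual_of_MW`
  (same `L²` space, `σ` self-dual), `…_of_selfDual_left_of_MW` — **the named fact's conclusion for
  these pairs, both halves**;
* `JacquetShalika1981_partialPairL_boundary_of_ne_one_of_MW_of_nonvanishing'` and
  `…_of_rank_ne'` — the named fact from the Mœglin–Waldspurger facts and Shahidi's non-vanishing
  **restricted to the pairs with neither member self-dual (and `σ ≇ π̃`)**;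
* `JacquetShalika1981_partialPairL_boundary_of_ne_one_of_MW_of_rank_one`, `…_left` — **the named
  fact for `GL_n × GL_1` and `GL_1 × GL_n`, `n ≥ 2`, from the Mœglin–Waldspurger facts alone**:
  `L^S(s, π × χ) = L^S(s, (π ⊗ χ) × 𝟙)` (`partialPairL_eq_twist_trivial`: the character absorbed
  into the cuspidal twist `π ⊗ χ`, `CuspidalAutomorphicRepGL.twistByChar`) with the trivial
  character `𝟙` self-dual (`exists_cuspidalAutomorphicRepGL_one_heckeCharacter_eq_one`) — de la
  Vallée Poussin's method thus recovers Jacquet–Shalika's (1976) `L(1 + it, π ⊗ χ) ≠ 0`, `t ≠ 0`,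
  from the continuation.

## References

* J. Arthur, L. Clozel, *Simple algebras, base change, and the advanced theory of the trace
  formula*, Ann. of Math. Stud. 120 (1989), Ch. 3 §2, (2.2), p. 171. [ArthurClozelAMS120]
* C. Mœglin, J.-L. Waldspurger, *Le spectre résiduel de `GL(n)`*, Ann. Sci. ÉNS (4) 22 (1989),
  Appendice, Corollaire, p. 667. [MoeglinWaldspurger1989]
* F. Shahidi, *On nonvanishing of `L`-functions*, Bull. AMS (N.S.) 2 (1980), 462–464, Theorem.
  [ShahidiBAMS1980]
* H. Jacquet, J. A. Shalika, *On Euler products and the classification of automorphic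
  representations I*, Amer. J. Math. 103 (1981), Thm. (5.3) and p. 556, (1)–(5). [JacquetShalikaAJM1981]
-/

noncomputable section

open scoped Topology ComplexOrder ComplexConjugate
open NumberField IsDedekindDomain MeasureTheory Filter Complex Asymptotics

namespace Literature.NumberTheory.Automorphic

open AdelicGroupData

/-! ### `L^S(s, α ⊗ β) = exp ∑_{(k,v)} tr A_v^k tr B_v^k q_v^{-ks}/k` on `Re s > 1` -/

section ExpExpansion

variable {K : Type} [Field K] [NumberField K]

/-- **Jacquet–Shalika (1981), p. 556, (1)–(5), kept to its sum.** For Satake families `α`, `β`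
with the bound (5.1.3) off `S` and (5.3.3) at `σ = re s > 1` for both, the double series
`∑_{v ∉ S} ∑_k tr A_v^k tr B_v^k q_v^{-ks}/k` (`pairLogTerm`) converges absolutely (Cauchy–Schwarz,
(5.3.5)) and `L^S(s, α ⊗ β) = partialPairL S α β s` is its exponential (sum over `k` = the local
logarithm (1); the exponential of a convergent sum is the convergent product (2)). Same proof as
`multipliable_inv_satakePairPolynomial`. [cite: JacquetShalikaAJM1981, Thm. (5.3), proof p. 556] -/
theorem summable_pairLogTerm_and_partialPairL_eq_exp {S : Set (HeightOneSpectrum (𝓞 K))}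
    {α β : SatakeFamily K}
    (hbα : ∀ v ∉ S, ∀ a ∈ α v, ‖a‖ ≤ Real.sqrt v.residueCard)
    (hbβ : ∀ v ∉ S, ∀ b ∈ β v, ‖b‖ ≤ Real.sqrt v.residueCard) {s : ℂ} (hs : 1 < s.re)
    (hA : Summable fun kv : ℕ × {v : HeightOneSpectrum (𝓞 K) // v ∉ S} =>
      ‖((α kv.2.1).map (· ^ (kv.1 + 1))).sum‖ ^ 2 /
        ((kv.1 + 1 : ℝ) * (kv.2.1.residueCard : ℝ) ^ ((kv.1 + 1 : ℝ) * s.re)))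
    (hB : Summable fun kv : ℕ × {v : HeightOneSpectrum (𝓞 K) // v ∉ S} =>
      ‖((β kv.2.1).map (· ^ (kv.1 + 1))).sum‖ ^ 2 /
        ((kv.1 + 1 : ℝ) * (kv.2.1.residueCard : ℝ) ^ ((kv.1 + 1 : ℝ) * s.re))) :
    Summable (pairLogTerm S α β s) ∧
      partialPairL S α β s = Complex.exp (∑' i, pairLogTerm S α β s i) := by
  have hx : ∀ v : {v : HeightOneSpectrum (𝓞 K) // v ∉ S},
      Real.sqrt v.1.residueCard * Real.sqrt v.1.residueCard * ‖(v.1.residueCard : ℂ) ^ (-s)‖ < 1 := by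
    intro v
    have hq1 : (1 : ℝ) < v.1.residueCard := by exact_mod_cast v.1.one_lt_residueCard
    have hq0 : (0 : ℝ) < v.1.residueCard := zero_lt_one.trans hq1
    rw [Real.mul_self_sqrt hq0.le, norm_natCast_cpow_of_pos (zero_lt_one.trans
      v.1.one_lt_residueCard), neg_re]
    calc (v.1.residueCard : ℝ) * (v.1.residueCard : ℝ) ^ (-s.re)
          = (v.1.residueCard : ℝ) ^ (1 + -s.re) := by rw [Real.rpow_add hq0, Real.rpow_one]
      _ < 1 := Real.rpow_lt_one_of_one_lt_of_neg hq1 (by linarith)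
  -- the double series (5), over `ℕ × {v ∉ S}`, converges absolutely by Cauchy–Schwarz
  have hT : Summable (pairLogTerm S α β s) :=
    Summable.of_norm_bounded (hA.add hB) fun kv =>
      norm_mul_mul_cpow_pow_div_le _ _ (zero_lt_one.trans kv.2.1.one_lt_residueCard) s kv.1
  refine ⟨hT, ?_⟩
  have hL := hT.hasSum
  -- sum first over `k` ((1): `log L(s, π_v × π'_v)`), then over `v`
  have hfib : ∀ v : {v : HeightOneSpectrum (𝓞 K) // v ∉ S},
      HasSum (fun k : ℕ => pairLogTerm S α β s (k, v))
        (-((satakeTensor (α v.1) (β v.1)).map fun c =>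
          Complex.log (1 - c * ((v.1.residueCard : ℂ) ^ (-s)))).sum) := fun v =>
    (hasSum_powerSum_mul_powerSum_mul_pow_div (hbα v.1 v.2) (hbβ v.1 v.2) (hx v)).congr_fun
      fun k => by simp only [pairLogTerm]
  have hG := HasSum.prod_fiberwise
    ((Equiv.prodComm {v : HeightOneSpectrum (𝓞 K) // v ∉ S} ℕ).hasSum_iff.mpr hL) hfib
  -- exponentiate ((2))
  have hP := hG.cexp
  have hfun : (cexp ∘ fun v : {v : HeightOneSpectrum (𝓞 K) // v ∉ S} =>
      -((satakeTensor (α v.1) (β v.1)).map fun c =>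
          Complex.log (1 - c * ((v.1.residueCard : ℂ) ^ (-s)))).sum) =
      fun v : {v : HeightOneSpectrum (𝓞 K) // v ∉ S} =>
        ((satakePairPolynomial (α v.1) (β v.1)).eval ((v.1.residueCard : ℂ) ^ (-s)))⁻¹ := by
    funext v
    simp only [Function.comp_apply]
    exact exp_neg_sum_log_eq_inv_eval_satakePairPolynomial (hbα v.1 v.2) (hbβ v.1 v.2) (hx v)
  rw [hfun] at hP
  rw [partialPairL, hP.tprod_eq]

variable {n m : ℕ} {μ : Measure (gl n K).automorphicQuotient} [(gl n K).IsAutomorphicMeasure μ]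
  {μ' : Measure (gl m K).automorphicQuotient} [(gl m K).IsAutomorphicMeasure μ']

/-- **`L^S(s, π ⊗ σ) = exp ∑_{(k,v)} tr A_v^k tr B_v^k q_v^{-ks}/k` on `Re s > 1`, unconditionally
for Satake families of cuspidal representations** of `GL_n(𝔸_K)`, `GL_m(𝔸_K)` ((5.1.3) and
(5.3.3) being the theorems `norm_satakeParameter_le_sqrt_holds`, `summable_normSq_trace_satakePow_holds`).
[cite: JacquetShalikaAJM1981, Thm. (5.3), proof p. 556] -/
theorem partialPairL_eq_exp_tsum_pairLogTerm (P : CuspidalAutomorphicRepGL n K μ)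
    (P' : CuspidalAutomorphicRepGL m K μ') {S : Set (HeightOneSpectrum (𝓞 K))}
    {α β : SatakeFamily K} (hα : IsSatakeFamilyOf P S α) (hβ : IsSatakeFamilyOf P' S β)
    {s : ℂ} (hs : 1 < s.re) :
    Summable (pairLogTerm S α β s) ∧
      partialPairL S α β s = Complex.exp (∑' i, pairLogTerm S α β s i) :=
  summable_pairLogTerm_and_partialPairL_eq_exp
    (fun _ hv _ ha => norm_satakeParameter_le_sqrt_holds P hα hv ha)
    (fun _ hv _ hb => norm_satakeParameter_le_sqrt_holds P' hβ hv hb) hs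
    (summable_normSq_trace_satakePow_holds P hα hs) (summable_normSq_trace_satakePow_holds P' hβ hs)

end ExpExpansion

/-! ### The positivity `(b + 2 Re(a w))² ≥ 0` and the inequality for a self-dual partner -/

section Positivity

variable {K : Type} [Field K] [NumberField K]

/-- For `b` real (`b̄ = b`) and `|w| = 1`:
`Re (b b̄ + 2 a ā + 4 a b w + 2 a² w²) = (b + 2 Re(a w))² ≥ 0`. [folklore] -/
theorem re_selfDual_comb_nonneg {a b w : ℂ} (hb : conj b = b) (hw : ‖w‖ = 1) :
    0 ≤ (b * conj b + 2 * (a * conj a) + 4 * (a * b * w) + 2 * (a ^ 2 * w ^ 2)).re := by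
  have hbim : b.im = 0 := conj_eq_iff_im.mp hb
  set z : ℂ := a * w with hz
  have hnw : normSq w = 1 := by rw [normSq_eq_norm_sq, hw, one_pow]
  have haa : a * conj a = z * conj z := by
    rw [mul_conj, mul_conj, hz, normSq_mul, hnw, mul_one]
  have hbb : b * conj b = ((b.re * b.re : ℝ) : ℂ) := by
    rw [mul_conj, normSq_apply, hbim, mul_zero, add_zero]
  rw [haa, show a * b * w = b * z by rw [hz]; ring, show a ^ 2 * w ^ 2 = z ^ 2 by rw [hz]; ring,
    hbb, mul_conj]
  have hre : (((b.re * b.re : ℝ) : ℂ) + 2 * ((normSq z : ℝ) : ℂ) + 4 * (b * z) + 2 * z ^ 2).re =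
      (b.re + 2 * z.re) ^ 2 := by
    have h2 : (2 : ℂ).re = 2 := rfl
    have h2' : (2 : ℂ).im = 0 := rfl
    have h4 : (4 : ℂ).re = 4 := rfl
    have h4' : (4 : ℂ).im = 0 := rfl
    simp only [add_re, mul_re, ofReal_re, ofReal_im, h2, h2', h4, h4', normSq_apply, sq, hbim,
      mul_im]
    ring
  rw [hre]
  positivity

/-- The `(k, v)`-terms of `log L^S(σ₀, β ⊗ β̄) + 2 log L^S(σ₀, α ⊗ ᾱ) + 4 log L^S(σ₀ + iy, α ⊗ β)
+ 2 log L^S(σ₀ + 2iy, α ⊗ α)`, `σ₀ = 1 + x`, have non-negative real part when `B̄_v = B_v`: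
`q_v^{-kσ₀} (b + 2 Re(a q_v^{-iky}))² / k ≥ 0`. [folklore] -/
theorem re_pairLogTerm_comb_nonneg {S : Set (HeightOneSpectrum (𝓞 K))} {α β : SatakeFamily K}
    (x y : ℝ) (i : ℕ × {v : HeightOneSpectrum (𝓞 K) // v ∉ S})
    (hβ : (β i.2.1).map conj = β i.2.1) :
    0 ≤ (pairLogTerm S β (conjFamily β) (1 + x) i + 2 * pairLogTerm S α (conjFamily α) (1 + x) i +
      4 * pairLogTerm S α β (1 + x + I * y) i +
      2 * pairLogTerm S α α (1 + x + 2 * I * y) i).re := by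
  obtain ⟨k, v⟩ := i
  set a : ℂ := ((α v.1).map (· ^ (k + 1))).sum with ha
  set b : ℂ := ((β v.1).map (· ^ (k + 1))).sum with hb
  have hca : (((α v.1).map conj).map (· ^ (k + 1))).sum = conj a := powerSum_map_conj (α v.1) (k + 1)
  have hcb : (((β v.1).map conj).map (· ^ (k + 1))).sum = conj b := powerSum_map_conj (β v.1) (k + 1)
  have hbreal : conj b = b := by
    rw [← hcb]
    simp only [hβ, hb]
  -- the pieces of `q^{-s}`
  set q : ℂ := (v.1.residueCard : ℂ) with hq
  have hq0 : q ≠ 0 := by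
    rw [hq]
    exact_mod_cast (zero_lt_one.trans v.1.one_lt_residueCard).ne'
  have hqpos : (0 : ℝ) < v.1.residueCard := by exact_mod_cast zero_lt_one.trans v.1.one_lt_residueCard
  set u : ℂ := q ^ (-(I * y)) with hu
  have hu_norm : ‖u‖ = 1 := by
    rw [hu, hq, Complex.norm_natCast_cpow_of_pos (zero_lt_one.trans v.1.one_lt_residueCard)]
    simp
  have hX : q ^ (-((1 : ℂ) + x)) = (((v.1.residueCard : ℝ) ^ (-(1 + x)) : ℝ) : ℂ) := by
    rw [hq, Complex.ofReal_cpow (Nat.cast_nonneg _)]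
    push_cast
    rfl
  have h1 : q ^ (-((1 : ℂ) + x + I * y)) = q ^ (-((1 : ℂ) + x)) * u := by
    rw [hu, ← Complex.cpow_add _ _ hq0]
    congr 1
    ring
  have h2 : q ^ (-((1 : ℂ) + x + 2 * I * y)) = q ^ (-((1 : ℂ) + x)) * u ^ 2 := by
    rw [hu, ← Complex.cpow_nat_mul, ← Complex.cpow_add _ _ hq0]
    congr 1
    push_cast
    ring
  -- the common non-negative real factor `c = q^{-(k+1)(1+x)} / (k+1)` and the phase `w = u^{k+1}`
  set c : ℝ := ((v.1.residueCard : ℝ) ^ (-(1 + x))) ^ (k + 1) / (k + 1) with hc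
  have hc0 : 0 ≤ c := by positivity
  set w : ℂ := u ^ (k + 1) with hw
  have hw_norm : ‖w‖ = 1 := by rw [hw, norm_pow, hu_norm, one_pow]
  have key : pairLogTerm S β (conjFamily β) (1 + x) (k, v) +
      2 * pairLogTerm S α (conjFamily α) (1 + x) (k, v) +
      4 * pairLogTerm S α β (1 + x + I * y) (k, v) +
      2 * pairLogTerm S α α (1 + x + 2 * I * y) (k, v) =
      (c : ℂ) * (b * conj b + 2 * (a * conj a) + 4 * (a * b * w) + 2 * (a ^ 2 * w ^ 2)) := by
    simp only [pairLogTerm, conjFamily_apply]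
    rw [hca, hcb, ← ha, ← hb, ← hq, h1, h2, hX, hc, hw]
    push_cast
    ring
  rw [key, Complex.re_ofReal_mul]
  exact mul_nonneg hc0 (re_selfDual_comb_nonneg hbreal hw_norm)

variable {n m : ℕ} {μ : Measure (gl n K).automorphicQuotient} [(gl n K).IsAutomorphicMeasure μ]
  {μ' : Measure (gl m K).automorphicQuotient} [(gl m K).IsAutomorphicMeasure μ']

/-- **de la Vallée Poussin's inequality for a self-dual partner.** For cuspidal `π` of `GL_n(𝔸_K)`
and `σ` of `GL_m(𝔸_K)` with Satake families `α`, `β` off `S`, `β` self-conjugate off `S`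
(`B̄_v = B_v`, `v ∉ S`: `σ` self-dual), `x > 0` and real `y`:
`‖L^S(1+x, β ⊗ β̄) · L^S(1+x, α ⊗ ᾱ)² · L^S(1+x+iy, α ⊗ β)⁴ · L^S(1+x+2iy, α ⊗ α)²‖ ≥ 1`.
[cite: JacquetShalikaAJM1981, Thm. (5.3), proof p. 556] -/
theorem one_le_norm_partialPairL_selfDual_product (P : CuspidalAutomorphicRepGL n K μ)
    (P' : CuspidalAutomorphicRepGL m K μ') {S : Set (HeightOneSpectrum (𝓞 K))}
    {α β : SatakeFamily K} (hα : IsSatakeFamilyOf P S α) (hβ : IsSatakeFamilyOf P' S β)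
    (hβc : ∀ v ∉ S, (β v).map conj = β v) {x : ℝ} (hx : 0 < x) (y : ℝ) :
    1 ≤ ‖partialPairL S β (conjFamily β) (1 + x) *
        partialPairL S α (conjFamily α) (1 + x) ^ 2 *
        partialPairL S α β (1 + x + I * y) ^ 4 *
        partialPairL S α α (1 + x + 2 * I * y) ^ 2‖ := by
  have hlt₁ : 1 < (1 + x : ℂ).re := by simp [hx]
  have hlt₂ : 1 < (1 + x + I * y : ℂ).re := by simp [hx]
  have hlt₃ : 1 < (1 + x + 2 * I * y : ℂ).re := by simp [hx]
  have hαc : IsSatakeFamilyOf P.conj S (conjFamily α) := hα.conj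
  have hβc' : IsSatakeFamilyOf P'.conj S (conjFamily β) := hβ.conj
  obtain ⟨hs₁, he₁⟩ := partialPairL_eq_exp_tsum_pairLogTerm P' P'.conj hβ hβc' hlt₁
  obtain ⟨hs₂, he₂⟩ := partialPairL_eq_exp_tsum_pairLogTerm P P.conj hα hαc hlt₁
  obtain ⟨hs₃, he₃⟩ := partialPairL_eq_exp_tsum_pairLogTerm P P' hα hβ hlt₂
  obtain ⟨hs₄, he₄⟩ := partialPairL_eq_exp_tsum_pairLogTerm P P hα hα hlt₃
  rw [he₁, he₂, he₃, he₄]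
  set A := ∑' i, pairLogTerm S β (conjFamily β) (1 + x) i
  set B := ∑' i, pairLogTerm S α (conjFamily α) (1 + x) i
  set C := ∑' i, pairLogTerm S α β (1 + x + I * y) i
  set D := ∑' i, pairLogTerm S α α (1 + x + 2 * I * y) i
  rw [show Complex.exp B ^ 2 = Complex.exp (2 * B) by
      rw [show (2 : ℂ) * B = ((2 : ℕ) : ℂ) * B by norm_num, Complex.exp_nat_mul],
    show Complex.exp C ^ 4 = Complex.exp (4 * C) by
      rw [show (4 : ℂ) * C = ((4 : ℕ) : ℂ) * C by norm_num, Complex.exp_nat_mul],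
    show Complex.exp D ^ 2 = Complex.exp (2 * D) by
      rw [show (2 : ℂ) * D = ((2 : ℕ) : ℂ) * D by norm_num, Complex.exp_nat_mul],
    ← Complex.exp_add, ← Complex.exp_add, ← Complex.exp_add, Complex.norm_exp, Real.one_le_exp_iff]
  have hs₂' : Summable fun i => 2 * pairLogTerm S α (conjFamily α) (1 + x) i := hs₂.mul_left 2
  have hs₃' : Summable fun i => 4 * pairLogTerm S α β (1 + x + I * y) i := hs₃.mul_left 4
  have hs₄' : Summable fun i => 2 * pairLogTerm S α α (1 + x + 2 * I * y) i := hs₄.mul_left 2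
  simp only [A, B, C, D]
  rw [← tsum_mul_left, ← tsum_mul_left, ← tsum_mul_left, ← hs₁.tsum_add hs₂',
    ← (hs₁.add hs₂').tsum_add hs₃', ← ((hs₁.add hs₂').add hs₃').tsum_add hs₄',
    Complex.re_tsum (((hs₁.add hs₂').add hs₃').add hs₄')]
  exact tsum_nonneg fun i => re_pairLogTerm_comb_nonneg x y i (hβc i.2.1 i.2.2)

end Positivity

/-! ### The endgame with three poles and four zeros -/

section Endgame

/-- `((1/x) · (1/x)² · x⁴ · 1² : ℂ) = x` (also at `x = 0`). [folklore] -/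
theorem one_div_mul_one_div_sq_mul_pow_four (x : ℝ) :
    ((1 / x) * (1 / x) ^ 2 * x ^ 4 * 1 ^ 2 : ℂ) = x := by
  rcases eq_or_ne x 0 with rfl | h
  · simp
  · have hx : (x : ℂ) ≠ 0 := ofReal_ne_zero.mpr h
    field_simp

/-- **The endgame.** If `L₁(1 + x) = O(1/x)`, `L₂(1 + x) = O(1/x)`, `L₃(1 + x + iy) = O(x)`,
`L₄(1 + x + 2iy) = O(1)` as `x → 0⁺` while `‖L₁(1+x) L₂(1+x)² L₃(1+x+iy)⁴ L₄(1+x+2iy)²‖ ≥ 1` for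
`x > 0`, contradiction (`(1/x)³ · x⁴ → 0`). [folklore] -/
theorem false_of_selfDual_estimates {L₁ L₂ L₃ L₄ : ℂ → ℂ} {y : ℝ}
    (H₁ : (fun x : ℝ => L₁ (1 + x)) =O[𝓝[>] 0] fun x => (1 : ℂ) / x)
    (H₂ : (fun x : ℝ => L₂ (1 + x)) =O[𝓝[>] 0] fun x => (1 : ℂ) / x)
    (H₃ : (fun x : ℝ => L₃ (1 + x + I * y)) =O[𝓝[>] 0] fun x => (x : ℂ))
    (H₄ : (fun x : ℝ => L₄ (1 + x + 2 * I * y)) =O[𝓝[>] 0] fun _ => (1 : ℂ))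
    (hpos : ∀ x : ℝ, 0 < x →
      1 ≤ ‖L₁ (1 + x) * L₂ (1 + x) ^ 2 * L₃ (1 + x + I * y) ^ 4 * L₄ (1 + x + 2 * I * y) ^ 2‖) :
    False := by
  have H := H₁.mul (H₂.pow 2) |>.mul (H₃.pow 4) |>.mul (H₄.pow 2)
  exact not_isBigO_ofReal_of_one_le_norm hpos
    (H.congr_right fun x => one_div_mul_one_div_sq_mul_pow_four x)

end Endgame

/-! ### Non-vanishing at `1 + it`, `t ≠ 0`, for a self-dual partner -/

section SelfDual

variable {n m : ℕ} {K : Type} [Field K] [NumberField K]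
  {μ : Measure (gl n K).automorphicQuotient} [(gl n K).IsAutomorphicMeasure μ]
  {μ' : Measure (gl m K).automorphicQuotient} [(gl m K).IsAutomorphicMeasure μ']

/-- A Satake family of a **self-dual** `σ` (`P' = P'.conj`) is self-conjugate off its exceptional
set: `B̄_v = B_v` for `v ∉ S` (uniqueness of Hecke–Satake parameters, `IsSatakeFamilyOf.conj`).
[folklore] -/
theorem map_conj_eq_of_eq_conj {P' : CuspidalAutomorphicRepGL m K μ'} (hsd : P' = P'.conj)
    {S : Set (HeightOneSpectrum (𝓞 K))} {β : SatakeFamily K} (hβ : IsSatakeFamilyOf P' S β)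
    {v : HeightOneSpectrum (𝓞 K)} (hv : v ∉ S) : (β v).map conj = β v := by
  have hβ' : IsSatakeFamilyOf P' S (conjFamily β) := by
    have h := hβ.conj
    rw [← hsd] at h
    exact h
  exact hβ'.eq_of_not_mem hβ hv hv

omit [(gl m K).IsAutomorphicMeasure μ'] in
/-- Corollaire (ii) for the pair `(π, π̄)`: an entire `G` with `G(s) = s (s - 1) L^S(s, α ⊗ ᾱ)` on
`Re s > 1`, hence `L^S(1 + x, α ⊗ ᾱ) = O(1/x)` as `x → 0⁺`.
[cite: MoeglinWaldspurger1989, Appendice, Corollaire (ii), p. 667] -/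
theorem isBigO_partialPairL_conjFamily_of_MW
    (h₃ : MoeglinWaldspurger1989_partialPairL_of_eq_conj (n := n) (K := K) (μ := μ))
    (hn : 0 < n) (P : CuspidalAutomorphicRepGL n K μ) {S : Set (HeightOneSpectrum (𝓞 K))}
    (hS : S.Finite) {α : SatakeFamily K} (hα : IsSatakeFamilyOf P S α) :
    (fun x : ℝ => partialPairL S α (conjFamily α) (1 + x)) =O[𝓝[>] 0] fun x => (1 : ℂ) / x := by
  have he : P = P.conj.conj := (CuspidalAutomorphicRepGL.conj_conj P).symm
  obtain ⟨G, hG, hGL⟩ := h₃ hn P P.conj he hS hα hα.conj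
  exact isBigO_horizontal_one_of_entire_mul hG hGL

omit [(gl m K).IsAutomorphicMeasure μ'] in
/-- Corollaire (i)(b)/(ii) for the pair `(π, π)` (split by multiplicity one according as `π ≅ π̄`
or not): `L^S(s, α ⊗ α)` has a continuation continuous at every `s₀ ∉ {0, 1}`, hence
`L^S(s₀ + x, α ⊗ α) = O(1)` as `x → 0⁺` for `Re s₀ = 1`, `s₀ ≠ 1`.
[cite: MoeglinWaldspurger1989, Appendice, Corollaire, p. 667] -/
theorem isBigO_partialPairL_self_of_MW
    (h₂ : MoeglinWaldspurger1989_partialPairL_entire_of_ne_conj (n := n) (K := K) (μ := μ))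
    (h₃ : MoeglinWaldspurger1989_partialPairL_of_eq_conj (n := n) (K := K) (μ := μ))
    (hm1 : Literature.NumberTheory.Automorphic.multiplicity_one_gl n K μ)
    (hn : 0 < n) (P : CuspidalAutomorphicRepGL n K μ) {S : Set (HeightOneSpectrum (𝓞 K))}
    (hS : S.Finite) {α : SatakeFamily K} (hα : IsSatakeFamilyOf P S α)
    {s₀ : ℂ} (hs₀ : s₀.re = 1) (hs₁ : s₀ ≠ 1) :
    (fun x : ℝ => partialPairL S α α (s₀ + x)) =O[𝓝[>] 0] fun _ => (1 : ℂ) := by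
  have h0 : s₀ ≠ 0 := by
    intro h
    rw [h] at hs₀
    simp at hs₀
  by_cases hP : P = P.conj
  · obtain ⟨G, hG, hGL⟩ := h₃ hn P P hP hS hα hα
    have hc : ContinuousAt (fun s => G s / (s * (s - 1))) s₀ :=
      ((hG s₀).div (differentiableAt_id.mul (differentiableAt_id.sub_const 1))
        (mul_ne_zero h0 (sub_ne_zero.mpr hs₁))).continuousAt
    refine isBigO_horizontal_of_continuousAt hs₀ hc fun s hs => ?_
    have hs0 : s ≠ 0 := by
      rintro rfl
      simp at hs
      linarith
    have hs1 : s - 1 ≠ 0 := by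
      intro h
      rw [sub_eq_zero] at h
      rw [h] at hs
      simp at hs
    rw [hGL s hs]
    field_simp
  · obtain ⟨g, hg, hgL⟩ := h₂ hn hm1 P P hP hS hα hα
    exact isBigO_horizontal_of_continuousAt hs₀ (hg s₀).continuousAt hgL

/-- **A continuation of `L^S(s, π ⊗ σ)` does not vanish at `1 + it`, `t ≠ 0`, when `σ` is
self-dual** (de la Vallée Poussin). For cuspidal `π` of `GL_n(𝔸_K)`, `σ` of `GL_m(𝔸_K)` with
`σ ≅ σ̃` (`P' = P'.conj`), Satake families `α`, `β` off a finite `S`, and `g` differentiable at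
`1 + iy` (`y ≠ 0`) with `g = L^S(·, α ⊗ β)` on `Re s > 1`: granted Corollaire (ii) at `GL_n` and
at `GL_m` and Corollaire (i)(b) with multiplicity one at `GL_n`, `g(1 + iy) ≠ 0` — by
`one_le_norm_partialPairL_selfDual_product` and the estimates `L^S(1+x, β ⊗ β̄), L^S(1+x, α ⊗ ᾱ) = O(1/x)`,
`L^S(1+x+iy, α ⊗ β) = O(x)` (if `g(1 + iy) = 0`), `L^S(1+x+2iy, α ⊗ α) = O(1)`.
[cite: ArthurClozelAMS120, Ch. 3 §2 (2.2)] [cite: MoeglinWaldspurger1989, Appendice, Corollaire, p. 667] -/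
theorem partialPairL_continuation_ne_zero_of_selfDual
    (h₂ : MoeglinWaldspurger1989_partialPairL_entire_of_ne_conj (n := n) (K := K) (μ := μ))
    (h₃ : MoeglinWaldspurger1989_partialPairL_of_eq_conj (n := n) (K := K) (μ := μ))
    (h₃' : MoeglinWaldspurger1989_partialPairL_of_eq_conj (n := m) (K := K) (μ := μ'))
    (hm1 : Literature.NumberTheory.Automorphic.multiplicity_one_gl n K μ)
    (hn : 0 < n) (hm : 0 < m) (P : CuspidalAutomorphicRepGL n K μ)
    (P' : CuspidalAutomorphicRepGL m K μ') (hsd : P' = P'.conj)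
    {S : Set (HeightOneSpectrum (𝓞 K))} (hS : S.Finite)
    {α β : SatakeFamily K} (hα : IsSatakeFamilyOf P S α) (hβ : IsSatakeFamilyOf P' S β)
    {g : ℂ → ℂ} {y : ℝ} (hy : y ≠ 0) (hg : DifferentiableAt ℂ g (1 + I * y))
    (hgL : ∀ s : ℂ, 1 < s.re → g s = partialPairL S α β s) : g (1 + I * y) ≠ 0 := by
  intro hg0
  have hre1 : (1 + I * y : ℂ).re = 1 := by simp
  have hre2 : (1 + 2 * I * y : ℂ).re = 1 := by simp
  have hne2 : (1 + 2 * I * y : ℂ) ≠ 1 := by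
    intro h
    have := congrArg Complex.im h
    simp [hy] at this
  -- the four horizontal estimates
  have H₁ : (fun x : ℝ => partialPairL S β (conjFamily β) (1 + x)) =O[𝓝[>] 0]
      fun x => (1 : ℂ) / x :=
    isBigO_partialPairL_conjFamily_of_MW h₃' hm P' hS hβ
  have H₂ : (fun x : ℝ => partialPairL S α (conjFamily α) (1 + x)) =O[𝓝[>] 0]
      fun x => (1 : ℂ) / x :=
    isBigO_partialPairL_conjFamily_of_MW h₃ hn P hS hα
  have H₃ : (fun x : ℝ => partialPairL S α β (1 + x + I * y)) =O[𝓝[>] 0] fun x => (x : ℂ) := by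
    refine (isBigO_horizontal_of_eq_zero hre1 hg hg0 hgL).congr' ?_ EventuallyEq.rfl
    filter_upwards with x
    show partialPairL S α β _ = partialPairL S α β _
    congr 1
    ring
  have H₄ : (fun x : ℝ => partialPairL S α α (1 + x + 2 * I * y)) =O[𝓝[>] 0]
      fun _ => (1 : ℂ) := by
    refine (isBigO_partialPairL_self_of_MW h₂ h₃ hm1 hn P hS hα hre2 hne2).congr' ?_
      EventuallyEq.rfl
    filter_upwards with x
    show partialPairL S α α _ = partialPairL S α α _
    congr 1
    ring
  exact false_of_selfDual_estimates H₁ H₂ H₃ H₄ fun x hx =>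
    one_le_norm_partialPairL_selfDual_product P P' hα hβ
      (fun v hv => map_conj_eq_of_eq_conj hsd hβ hv) hx y

/-- From a continuation `g` differentiable at `s₀` (`Re s₀ = 1`, `s₀ ≠ 1`) of `L^S(s, π ⊗ σ)` with
`σ` self-dual: the limit at `s₀` from `Re s > 1` exists and is **non-zero**.
[cite: ArthurClozelAMS120, Ch. 3 §2 (2.2)] -/
theorem exists_ne_zero_tendsto_partialPairL_of_selfDual_of_continuation
    (h₂ : MoeglinWaldspurger1989_partialPairL_entire_of_ne_conj (n := n) (K := K) (μ := μ))
    (h₃ : MoeglinWaldspurger1989_partialPairL_of_eq_conj (n := n) (K := K) (μ := μ))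
    (h₃' : MoeglinWaldspurger1989_partialPairL_of_eq_conj (n := m) (K := K) (μ := μ'))
    (hm1 : Literature.NumberTheory.Automorphic.multiplicity_one_gl n K μ)
    (hn : 0 < n) (hm : 0 < m) (P : CuspidalAutomorphicRepGL n K μ)
    (P' : CuspidalAutomorphicRepGL m K μ') (hsd : P' = P'.conj)
    {S : Set (HeightOneSpectrum (𝓞 K))} (hS : S.Finite)
    {α β : SatakeFamily K} (hα : IsSatakeFamilyOf P S α) (hβ : IsSatakeFamilyOf P' S β)
    {g : ℂ → ℂ} {s₀ : ℂ} (hs₀ : s₀.re = 1) (hs₁ : s₀ ≠ 1) (hg : DifferentiableAt ℂ g s₀)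
    (hgL : ∀ s : ℂ, 1 < s.re → g s = partialPairL S α β s) :
    ∃ c : ℂ, c ≠ 0 ∧ Tendsto (partialPairL S α β) (𝓝[{s : ℂ | 1 < s.re}] s₀) (𝓝 c) := by
  have hy : s₀.im ≠ 0 := (ne_one_iff_im_ne_zero_of_re_eq_one hs₀).mp hs₁
  have hs' : s₀ = 1 + I * s₀.im := by
    conv_lhs => rw [← re_add_im s₀, hs₀, ofReal_one, mul_comm]
  refine ⟨g s₀, ?_, tendsto_of_continuousAt_extension hg.continuousAt hgL⟩
  rw [hs'] at hg ⊢
  exact partialPairL_continuation_ne_zero_of_selfDual h₂ h₃ h₃' hm1 hn hm P P' hsd hS hα hβ hy hg hgL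

/-- **Arthur–Clozel (2.2) off `s = 1`, `n ≠ m`, `σ` self-dual — both halves, granted the
Mœglin–Waldspurger facts** (Corollaire (i)(a) for the pair, (ii) at `GL_n` and `GL_m`, (i)(b) with
multiplicity one at `GL_n`): `L^S(s, π ⊗ σ) → c ≠ 0` as `s → s₀`, `Re s > 1`, at every `s₀ ≠ 1` of
the line. [cite: ArthurClozelAMS120, Ch. 3 §2 (2.2)]
[cite: MoeglinWaldspurger1989, Appendice, Corollaire, p. 667] -/
theorem JacquetShalika1981_partialPairL_boundary_of_ne_one_of_selfDual_of_MW_of_rank_ne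
    (h₁ : MoeglinWaldspurger1989_partialPairL_entire_of_rank_ne (n := n) (m := m) (K := K)
      (μ := μ) (μ' := μ'))
    (h₂ : MoeglinWaldspurger1989_partialPairL_entire_of_ne_conj (n := n) (K := K) (μ := μ))
    (h₃ : MoeglinWaldspurger1989_partialPairL_of_eq_conj (n := n) (K := K) (μ := μ))
    (h₃' : MoeglinWaldspurger1989_partialPairL_of_eq_conj (n := m) (K := K) (μ := μ'))
    (hm1 : Literature.NumberTheory.Automorphic.multiplicity_one_gl n K μ)
    (hnm : n ≠ m) (hn : 0 < n) (hm : 0 < m) (P : CuspidalAutomorphicRepGL n K μ)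
    (P' : CuspidalAutomorphicRepGL m K μ') (hsd : P' = P'.conj)
    {S : Set (HeightOneSpectrum (𝓞 K))} (hS : S.Finite)
    {α β : SatakeFamily K} (hα : IsSatakeFamilyOf P S α) (hβ : IsSatakeFamilyOf P' S β)
    {s₀ : ℂ} (hs₀ : s₀.re = 1) (hs₁ : s₀ ≠ 1) :
    ∃ c : ℂ, c ≠ 0 ∧ Tendsto (partialPairL S α β) (𝓝[{s : ℂ | 1 < s.re}] s₀) (𝓝 c) := by
  obtain ⟨g, hg, hgL⟩ := h₁ hnm hn hm P P' hS hα hβ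
  exact exists_ne_zero_tendsto_partialPairL_of_selfDual_of_continuation h₂ h₃ h₃' hm1 hn hm P P'
    hsd hS hα hβ hs₀ hs₁ (hg s₀) hgL

/-- The same with **`π` self-dual** (`P = P.conj`), `n ≠ m`, by the symmetry
`L^S(s, α ⊗ β) = L^S(s, β ⊗ α)` (`partialPairL_comm`); the Mœglin–Waldspurger inputs (i)(b) and
multiplicity one are now needed at `GL_m`. [cite: ArthurClozelAMS120, Ch. 3 §2 (2.2)] -/
theorem JacquetShalika1981_partialPairL_boundary_of_ne_one_of_selfDual_left_of_MW_of_rank_ne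
    (h₁ : MoeglinWaldspurger1989_partialPairL_entire_of_rank_ne (n := n) (m := m) (K := K)
      (μ := μ) (μ' := μ'))
    (h₂' : MoeglinWaldspurger1989_partialPairL_entire_of_ne_conj (n := m) (K := K) (μ := μ'))
    (h₃ : MoeglinWaldspurger1989_partialPairL_of_eq_conj (n := n) (K := K) (μ := μ))
    (h₃' : MoeglinWaldspurger1989_partialPairL_of_eq_conj (n := m) (K := K) (μ := μ'))
    (hm1' : Literature.NumberTheory.Automorphic.multiplicity_one_gl m K μ')
    (hnm : n ≠ m) (hn : 0 < n) (hm : 0 < m) (P : CuspidalAutomorphicRepGL n K μ)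
    (P' : CuspidalAutomorphicRepGL m K μ') (hsd : P = P.conj)
    {S : Set (HeightOneSpectrum (𝓞 K))} (hS : S.Finite)
    {α β : SatakeFamily K} (hα : IsSatakeFamilyOf P S α) (hβ : IsSatakeFamilyOf P' S β)
    {s₀ : ℂ} (hs₀ : s₀.re = 1) (hs₁ : s₀ ≠ 1) :
    ∃ c : ℂ, c ≠ 0 ∧ Tendsto (partialPairL S α β) (𝓝[{s : ℂ | 1 < s.re}] s₀) (𝓝 c) := by
  obtain ⟨g, hg, hgL⟩ := h₁ hnm hn hm P P' hS hα hβ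
  rw [partialPairL_comm S α β]
  have hgL' : ∀ s : ℂ, 1 < s.re → g s = partialPairL S β α s := fun s hs => by
    rw [hgL s hs, partialPairL_comm S α β]
  exact exists_ne_zero_tendsto_partialPairL_of_selfDual_of_continuation h₂' h₃' h₃ hm1' hm hn P' P
    hsd hS hβ hα hs₀ hs₁ (hg s₀) hgL'

omit [(gl m K).IsAutomorphicMeasure μ'] in
/-- **Arthur–Clozel (2.2) off `s = 1` in one `L²` space, `σ` self-dual, `π ≇ σ̃` — both halves,
granted Corollaire (i)(b), (ii) and multiplicity one at `GL_n`.** (The pairs `π ≅ σ̃` are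
`JacquetShalika1981_partialPairL_boundary_of_ne_one_of_eq_conj_of_MW`.)
[cite: ArthurClozelAMS120, Ch. 3 §2 (2.2)] [cite: MoeglinWaldspurger1989, Appendice, Corollaire, p. 667] -/
theorem JacquetShalika1981_partialPairL_boundary_of_ne_one_of_selfDual_of_MW
    (h₂ : MoeglinWaldspurger1989_partialPairL_entire_of_ne_conj (n := n) (K := K) (μ := μ))
    (h₃ : MoeglinWaldspurger1989_partialPairL_of_eq_conj (n := n) (K := K) (μ := μ))
    (hm1 : Literature.NumberTheory.Automorphic.multiplicity_one_gl n K μ)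
    (hn : 0 < n) (P P' : CuspidalAutomorphicRepGL n K μ) (hne : P ≠ P'.conj) (hsd : P' = P'.conj)
    {S : Set (HeightOneSpectrum (𝓞 K))} (hS : S.Finite)
    {α β : SatakeFamily K} (hα : IsSatakeFamilyOf P S α) (hβ : IsSatakeFamilyOf P' S β)
    {s₀ : ℂ} (hs₀ : s₀.re = 1) (hs₁ : s₀ ≠ 1) :
    ∃ c : ℂ, c ≠ 0 ∧ Tendsto (partialPairL S α β) (𝓝[{s : ℂ | 1 < s.re}] s₀) (𝓝 c) := by
  obtain ⟨g, hg, hgL⟩ := h₂ hn hm1 P P' hne hS hα hβ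
  exact exists_ne_zero_tendsto_partialPairL_of_selfDual_of_continuation h₂ h₃ h₃ hm1 hn hn P P'
    hsd hS hα hβ hs₀ hs₁ (hg s₀) hgL

omit [(gl m K).IsAutomorphicMeasure μ'] in
/-- The same with **`π` self-dual**, `π ≇ σ̃`, in one `L²` space. [cite: ArthurClozelAMS120, Ch. 3 §2 (2.2)] -/
theorem JacquetShalika1981_partialPairL_boundary_of_ne_one_of_selfDual_left_of_MW
    (h₂ : MoeglinWaldspurger1989_partialPairL_entire_of_ne_conj (n := n) (K := K) (μ := μ))
    (h₃ : MoeglinWaldspurger1989_partialPairL_of_eq_conj (n := n) (K := K) (μ := μ))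
    (hm1 : Literature.NumberTheory.Automorphic.multiplicity_one_gl n K μ)
    (hn : 0 < n) (P P' : CuspidalAutomorphicRepGL n K μ) (hne : P ≠ P'.conj) (hsd : P = P.conj)
    {S : Set (HeightOneSpectrum (𝓞 K))} (hS : S.Finite)
    {α β : SatakeFamily K} (hα : IsSatakeFamilyOf P S α) (hβ : IsSatakeFamilyOf P' S β)
    {s₀ : ℂ} (hs₀ : s₀.re = 1) (hs₁ : s₀ ≠ 1) :
    ∃ c : ℂ, c ≠ 0 ∧ Tendsto (partialPairL S α β) (𝓝[{s : ℂ | 1 < s.re}] s₀) (𝓝 c) := by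
  obtain ⟨g, hg, hgL⟩ := h₂ hn hm1 P P' hne hS hα hβ
  rw [partialPairL_comm S α β]
  have hgL' : ∀ s : ℂ, 1 < s.re → g s = partialPairL S β α s := fun s hs => by
    rw [hgL s hs, partialPairL_comm S α β]
  exact exists_ne_zero_tendsto_partialPairL_of_selfDual_of_continuation h₂ h₃ h₃ hm1 hn hn P' P
    hsd hS hβ hα hs₀ hs₁ (hg s₀) hgL'

end SelfDual

/-! ### Assemblies: Shahidi's theorem is needed only for pairs without a self-dual member -/

section Assembly

variable {n m : ℕ} {K : Type} [Field K] [NumberField K]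
  {μ : Measure (gl n K).automorphicQuotient} [(gl n K).IsAutomorphicMeasure μ]
  {μ' : Measure (gl m K).automorphicQuotient} [(gl m K).IsAutomorphicMeasure μ']

omit [(gl m K).IsAutomorphicMeasure μ'] in
/-- **Arthur–Clozel (2.2) off `s = 1` at ranks `(n, n)` (one `L²` space), from Mœglin–Waldspurger
and Shahidi for the pairs without a self-dual member.** Granted Corollaire (i)(b), (ii),
multiplicity one on `L²_cusp(GL_n(𝔸_K))`, and Shahidi's non-vanishing (limit form) **only for the
pairs `(π, σ)` with `π ≇ σ̃`, `π ≇ π̃`, `σ ≇ σ̃`**, the named fact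
`JacquetShalika1981_partialPairL_boundary_of_ne_one` holds at `(n, n)`.
[cite: ArthurClozelAMS120, Ch. 3 §2 (2.2)] [cite: ShahidiBAMS1980, Theorem p. 462]
[cite: MoeglinWaldspurger1989, Appendice, Corollaire, p. 667] -/
theorem JacquetShalika1981_partialPairL_boundary_of_ne_one_of_MW_of_nonvanishing'
    (h₂ : MoeglinWaldspurger1989_partialPairL_entire_of_ne_conj (n := n) (K := K) (μ := μ))
    (h₃ : MoeglinWaldspurger1989_partialPairL_of_eq_conj (n := n) (K := K) (μ := μ))
    (hm1 : Literature.NumberTheory.Automorphic.multiplicity_one_gl n K μ)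
    (hSh : ∀ (P P' : CuspidalAutomorphicRepGL n K μ) (_hne : P ≠ P'.conj) (_hP : P ≠ P.conj)
      (_hP' : P' ≠ P'.conj) {S : Set (HeightOneSpectrum (𝓞 K))} (_hS : S.Finite)
      {α β : SatakeFamily K} (_hα : IsSatakeFamilyOf P S α) (_hβ : IsSatakeFamilyOf P' S β)
      {s₀ : ℂ} (_hs₀ : s₀.re = 1) (_hs₁ : s₀ ≠ 1) (c : ℂ)
      (_hc : Tendsto (partialPairL S α β) (𝓝[{s : ℂ | 1 < s.re}] s₀) (𝓝 c)), c ≠ 0) :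
    JacquetShalika1981_partialPairL_boundary_of_ne_one (n := n) (m := n) (K := K) (μ := μ)
      (μ' := μ) := by
  intro hn _ P P' S hS α β hα hβ s₀ hs₀ hs₁
  by_cases he : P = P'.conj
  · exact JacquetShalika1981_partialPairL_boundary_of_ne_one_of_eq_conj_of_MW h₃ hn P P' he hS hα hβ
      hs₀ hs₁
  by_cases hP' : P' = P'.conj
  · exact JacquetShalika1981_partialPairL_boundary_of_ne_one_of_selfDual_of_MW h₂ h₃ hm1 hn P P' he
      hP' hS hα hβ hs₀ hs₁
  by_cases hP : P = P.conj
  · exact JacquetShalika1981_partialPairL_boundary_of_ne_one_of_selfDual_left_of_MW h₂ h₃ hm1 hn P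
      P' he hP hS hα hβ hs₀ hs₁
  · obtain ⟨c, hc⟩ := exists_tendsto_partialPairL_of_MW_of_ne_conj h₂ hn hm1 P P' he hS hα hβ s₀
    exact ⟨c, hSh P P' he hP hP' hS hα hβ hs₀ hs₁ c hc, hc⟩

/-- **Arthur–Clozel (2.2) off `s = 1` for `n ≠ m`, from Mœglin–Waldspurger and Shahidi for the
pairs without a self-dual member.** Granted Corollaire (i)(a) for the pairs, (i)(b), (ii) and
multiplicity one at `GL_n` and at `GL_m`, and Shahidi's non-vanishing (limit form) **only for the
pairs with `π ≇ π̃` and `σ ≇ σ̃`**, the named fact holds at `(n, m)`.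
[cite: ArthurClozelAMS120, Ch. 3 §2 (2.2)] [cite: ShahidiBAMS1980, Theorem p. 462]
[cite: MoeglinWaldspurger1989, Appendice, Corollaire, p. 667] -/
theorem JacquetShalika1981_partialPairL_boundary_of_ne_one_of_MW_of_nonvanishing_of_rank_ne'
    (h₁ : MoeglinWaldspurger1989_partialPairL_entire_of_rank_ne (n := n) (m := m) (K := K)
      (μ := μ) (μ' := μ'))
    (h₂ : MoeglinWaldspurger1989_partialPairL_entire_of_ne_conj (n := n) (K := K) (μ := μ))
    (h₂' : MoeglinWaldspurger1989_partialPairL_entire_of_ne_conj (n := m) (K := K) (μ := μ'))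
    (h₃ : MoeglinWaldspurger1989_partialPairL_of_eq_conj (n := n) (K := K) (μ := μ))
    (h₃' : MoeglinWaldspurger1989_partialPairL_of_eq_conj (n := m) (K := K) (μ := μ'))
    (hm1 : Literature.NumberTheory.Automorphic.multiplicity_one_gl n K μ)
    (hm1' : Literature.NumberTheory.Automorphic.multiplicity_one_gl m K μ')
    (hnm : n ≠ m)
    (hSh : ∀ (_hn : 0 < n) (_hm : 0 < m) (P : CuspidalAutomorphicRepGL n K μ)
      (P' : CuspidalAutomorphicRepGL m K μ') (_hP : P ≠ P.conj) (_hP' : P' ≠ P'.conj)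
      {S : Set (HeightOneSpectrum (𝓞 K))} (_hS : S.Finite)
      {α β : SatakeFamily K} (_hα : IsSatakeFamilyOf P S α) (_hβ : IsSatakeFamilyOf P' S β)
      {s₀ : ℂ} (_hs₀ : s₀.re = 1) (_hs₁ : s₀ ≠ 1) (c : ℂ)
      (_hc : Tendsto (partialPairL S α β) (𝓝[{s : ℂ | 1 < s.re}] s₀) (𝓝 c)), c ≠ 0) :
    JacquetShalika1981_partialPairL_boundary_of_ne_one (n := n) (m := m) (K := K) (μ := μ)
      (μ' := μ') := by
  intro hn hm P P' S hS α β hα hβ s₀ hs₀ hs₁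
  by_cases hP' : P' = P'.conj
  · exact JacquetShalika1981_partialPairL_boundary_of_ne_one_of_selfDual_of_MW_of_rank_ne h₁ h₂ h₃
      h₃' hm1 hnm hn hm P P' hP' hS hα hβ hs₀ hs₁
  by_cases hP : P = P.conj
  · exact JacquetShalika1981_partialPairL_boundary_of_ne_one_of_selfDual_left_of_MW_of_rank_ne h₁
      h₂' h₃ h₃' hm1' hnm hn hm P P' hP hS hα hβ hs₀ hs₁
  · obtain ⟨c, hc⟩ := exists_tendsto_partialPairL_of_MW_of_rank_ne h₁ hnm hn hm P P' hS hα hβ s₀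
    exact ⟨c, hSh hn hm P P' hP hP' hS hα hβ hs₀ hs₁ c hc, hc⟩

end Assembly


/-! ### `GL_n × GL_1` and `GL_1 × GL_n` (`n ≥ 2`): the character absorbed into the twist, the
trivial character being self-dual -/

section RankOne

variable {n : ℕ} {K : Type} [Field K] [NumberField K]
  {μ : Measure (gl n K).automorphicQuotient} [(gl n K).IsAutomorphicMeasure μ]
  {μ₁ : Measure (gl 1 K).automorphicQuotient} [(gl 1 K).IsAutomorphicMeasure μ₁]

omit [(gl n K).IsAutomorphicMeasure μ] in
/-- **The trivial representation of `GL_1(𝔸_K)`** in `L²_cusp(GL_1)`: a cuspidal `P₁` with Hecke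
character `χ_{P₁} = 1` (`CuspidalAutomorphicRepGL.exists_heckeCharacter_eq`, the constants); it is
**self-dual**, `P₁ = P₁.conj` (`χ_{P̄₁} = χ_{P₁}⁻¹ = 1` and multiplicity one for `GL_1`,
`CuspidalAutomorphicRepGL.eq_of_heckeCharacter_eq`). [folklore] -/
theorem exists_cuspidalAutomorphicRepGL_one_heckeCharacter_eq_one :
    ∃ P₁ : CuspidalAutomorphicRepGL 1 K μ₁, P₁.heckeCharacter = 1 ∧ P₁ = P₁.conj := by
  obtain ⟨P₁, h1, -⟩ := CuspidalAutomorphicRepGL.exists_heckeCharacter_eq (μ := μ₁)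
    (1 : Literature.NumberTheory.GaloisRepresentations.HeckeCharacter K)
    Literature.NumberTheory.GaloisRepresentations.HeckeCharacter.isUnitary_one (fun _ => rfl)
  refine ⟨P₁, h1, CuspidalAutomorphicRepGL.eq_of_heckeCharacter_eq ?_⟩
  rw [CuspidalAutomorphicRepGL.heckeCharacter_conj, h1, inv_one]

omit [(gl n K).IsAutomorphicMeasure μ] in
/-- **Absorbing the character into the twist**: for Satake families `β` of `χ : GL_1` and `β₁` of
the trivial `𝟙 : GL_1` off `S`, and any family `α`,
`L^S(s, α ⊗ β) = L^S(s, χ(ϖ_v) α ⊗ β₁)` — both are the partial standard `L`-function of the twisted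
family `v ↦ χ(ϖ_v) α(v)` (`partialPairL_eq_partialStandardL_twist`).
[cite: ArthurClozelAMS120, Ch. 3, p. 172] -/
theorem partialPairL_eq_twist_trivial {P' P₁ : CuspidalAutomorphicRepGL 1 K μ₁}
    (h1 : P₁.heckeCharacter = 1) {S : Set (HeightOneSpectrum (𝓞 K))} {α β β₁ : SatakeFamily K}
    (hβ : IsSatakeFamilyOf P' S β) (hβ₁ : IsSatakeFamilyOf P₁ S β₁) :
    partialPairL S α β =
      partialPairL S (fun v => (α v).map (P'.heckeCharacter.valueAtUniformizer v * ·)) β₁ := by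
  rw [partialPairL_eq_partialStandardL_twist hβ α, partialPairL_eq_partialStandardL_twist hβ₁]
  congr 1
  funext v
  have hv1 : (1 : Literature.NumberTheory.GaloisRepresentations.HeckeCharacter K).valueAtUniformizer v
      = 1 := by
    rw [Literature.NumberTheory.GaloisRepresentations.HeckeCharacter.valueAtUniformizer,
      Literature.NumberTheory.GaloisRepresentations.HeckeCharacter.localComponent_apply,
      Literature.NumberTheory.GaloisRepresentations.HeckeCharacter.one_apply, Units.val_one]
  rw [h1, hv1]
  simp only [one_mul, Multiset.map_id']

/-- **Arthur–Clozel (2.2) off `s = 1` for `GL_n × GL_1`, `n ≥ 2` — both halves, from the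
Mœglin–Waldspurger facts alone** (Corollaire (i)(a) at `(n, 1)`, (i)(b) and (ii) with multiplicity
one at `GL_n`, (ii) at `GL_1`): for every cuspidal `π` of `GL_n(𝔸_K)` and idele class character
`χ` (cuspidal of `GL_1(𝔸_K)`), all finite `S` and Satake families off `S`, and every `s₀ ≠ 1` of the
line `Re s = 1`, `L^S(s, π ⊗ χ) → c ≠ 0`. The non-vanishing — in print Jacquet–Shalika's (1976)
theorem `L(1 + it, π ⊗ χ) ≠ 0` — is obtained here by de la Vallée Poussin's method:
`L^{S₀}(s, π × χ) = L^{S₀}(s, (π ⊗ χ) × 𝟙)` with `𝟙` self-dual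
(`partialPairL_eq_twist_trivial`, the twist `CuspidalAutomorphicRepGL.twistByChar` with its family
`IsSatakeFamilyOf.twistByChar` off a level of `χ`, `HeckeCharacter.exists_level`), to which
`exists_ne_zero_tendsto_partialPairL_of_selfDual_of_continuation` applies; the passage to arbitrary
`(S, α, β)` is `JacquetShalika1981_partialPairL_boundary_of_ne_one_of_one_family_of_le_two'`
(the strict bound at `GL_1` being a theorem). [cite: ArthurClozelAMS120, Ch. 3 §2 (2.2) and p. 172]
[cite: MoeglinWaldspurger1989, Appendice, Corollaire, p. 667] -/
theorem JacquetShalika1981_partialPairL_boundary_of_ne_one_of_MW_of_rank_one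
    (h₁ : MoeglinWaldspurger1989_partialPairL_entire_of_rank_ne (n := n) (m := 1) (K := K)
      (μ := μ) (μ' := μ₁))
    (h₂ : MoeglinWaldspurger1989_partialPairL_entire_of_ne_conj (n := n) (K := K) (μ := μ))
    (h₃ : MoeglinWaldspurger1989_partialPairL_of_eq_conj (n := n) (K := K) (μ := μ))
    (h₃₁ : MoeglinWaldspurger1989_partialPairL_of_eq_conj (n := 1) (K := K) (μ := μ₁))
    (hm1 : Literature.NumberTheory.Automorphic.multiplicity_one_gl n K μ) (hn1 : n ≠ 1) :
    JacquetShalika1981_partialPairL_boundary_of_ne_one (n := n) (m := 1) (K := K) (μ := μ)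
      (μ' := μ₁) := by
  classical
  refine JacquetShalika1981_partialPairL_boundary_of_ne_one_of_one_family_of_le_two' (by norm_num) ?_
  intro hn _ P P' s₀ hs₀ hs₁
  obtain ⟨S₁, α, -, hα⟩ := exists_isSatakeFamilyOf_holds (n := n) (K := K) (μ := μ) P
  obtain ⟨S₂, β, -, hβ⟩ := exists_isSatakeFamilyOf_holds (n := 1) (K := K) (μ := μ₁) P'
  obtain ⟨P₁, hP₁, hsd⟩ := exists_cuspidalAutomorphicRepGL_one_heckeCharacter_eq_one (K := K)
    (μ₁ := μ₁)
  obtain ⟨S₃, β₁, -, hβ₁⟩ := exists_isSatakeFamilyOf_holds (n := 1) (K := K) (μ := μ₁) P₁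
  obtain ⟨𝔪, h𝔪, hχ𝔪⟩ := P'.heckeCharacter.exists_level n
  have hT : {v : HeightOneSpectrum (𝓞 K) | v.asIdeal ∣ 𝔪}.Finite := Ideal.finite_factors h𝔪
  set S₀ : Set (HeightOneSpectrum (𝓞 K)) :=
    ((↑S₁ ∪ ↑S₂) ∪ ↑S₃) ∪ {v : HeightOneSpectrum (𝓞 K) | v.asIdeal ∣ 𝔪} with hS₀_def
  have hS₀ : S₀.Finite :=
    ((S₁.finite_toSet.union S₂.finite_toSet).union S₃.finite_toSet).union hT
  have hα₀ : IsSatakeFamilyOf P S₀ α :=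
    hα.mono ((Set.subset_union_left.trans Set.subset_union_left).trans Set.subset_union_left)
  have hβ₀ : IsSatakeFamilyOf P' S₀ β :=
    hβ.mono ((Set.subset_union_right.trans Set.subset_union_left).trans Set.subset_union_left)
  have hβ₁₀ : IsSatakeFamilyOf P₁ S₀ β₁ :=
    hβ₁.mono (Set.subset_union_right.trans Set.subset_union_left)
  -- the twist `π ⊗ χ` and its Satake family `χ(ϖ_v) α(v)` off `S₀`
  have hγ := hα₀.twistByChar P'.heckeCharacter P'.isUnitary_heckeCharacter
    P'.heckeCharacter_posRealIdele h𝔪 hχ𝔪 (fun v hv hdvd => hv (Set.mem_union_right _ hdvd))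
  refine ⟨S₀, α, β, hS₀, hα₀, hβ₀, ?_⟩
  rw [partialPairL_eq_twist_trivial hP₁ hβ₀ hβ₁₀]
  -- a continuation of `L^{S₀}(s, (π ⊗ χ) × 𝟙)` from Corollaire (i)(a) at `(n, 1)`
  obtain ⟨g, hg, hgL⟩ := h₁ hn1 hn one_pos _ P₁ hS₀ hγ hβ₁₀
  exact exists_ne_zero_tendsto_partialPairL_of_selfDual_of_continuation h₂ h₃ h₃₁ hm1 hn one_pos _
    P₁ hsd hS₀ hγ hβ₁₀ hs₀ hs₁ (hg s₀) hgL

/-- **Arthur–Clozel (2.2) off `s = 1` for `GL_1 × GL_n`, `n ≥ 2`, from the Mœglin–Waldspurger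
facts alone** (by `partialPairL_comm` from the `GL_n × GL_1` case). [cite: ArthurClozelAMS120, Ch. 3 §2 (2.2)] -/
theorem JacquetShalika1981_partialPairL_boundary_of_ne_one_of_MW_of_rank_one_left
    (h₁ : MoeglinWaldspurger1989_partialPairL_entire_of_rank_ne (n := n) (m := 1) (K := K)
      (μ := μ) (μ' := μ₁))
    (h₂ : MoeglinWaldspurger1989_partialPairL_entire_of_ne_conj (n := n) (K := K) (μ := μ))
    (h₃ : MoeglinWaldspurger1989_partialPairL_of_eq_conj (n := n) (K := K) (μ := μ))
    (h₃₁ : MoeglinWaldspurger1989_partialPairL_of_eq_conj (n := 1) (K := K) (μ := μ₁))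
    (hm1 : Literature.NumberTheory.Automorphic.multiplicity_one_gl n K μ) (hn1 : n ≠ 1) :
    JacquetShalika1981_partialPairL_boundary_of_ne_one (n := 1) (m := n) (K := K) (μ := μ₁)
      (μ' := μ) := by
  intro h1 hn P P' S hS α β hα hβ s₀ hs₀ hs₁
  rw [partialPairL_comm S α β]
  exact JacquetShalika1981_partialPairL_boundary_of_ne_one_of_MW_of_rank_one h₁ h₂ h₃ h₃₁ hm1 hn1
    hn h1 P' P hS hβ hα hs₀ hs₁

end RankOne


end Literature.NumberTheory.Automorphic
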